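import Summits.Langlands.Langlands.Theorems.TwoDivisionFieldSplitPrelude

/-!
# TwoDivisionFieldSplit (MAIN: §4–§5 — kernel, exactness, compositions; §1–§3 in `TwoDivisionFieldSplitPrelude`) — lens-5 g29 node on RES = `DyadicDoorSplit.DyadicDegenerateResidual`

TARGET (tree decl, BY NAME): RES = `Summit.Langlands.Langlands.Theorems.DyadicDoorSplit.DyadicDegenerateResidual`
(g28, `Theorems/DyadicDoorSplitPrelude.lean`): every integral `E` (`Δ ≠ 0`) over an UNANCHORED totally real field
`K₀` of degree `≥ 6` (`DepthIsolationSplit.UnanchoredBox K₀`), of residual moduli degree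
(`JDegreeFilterSplit.InResidualRange K₀ E`), OFF the Allen locus, is modular.  RES is the declared residual of the
lineage REST (stmt-Langlands-26998) → REST_E (g26) → LJR (g27) → ADS ∧ RES (g28); g28 typed RES as the conjunction
of four sub-loci R_tors ∧ R_sq ∧ R_ss ∧ R_cm (`residual_iff_subloci`), all IDEA-NEEDED.

THESIS (lens «finite range + generic regime + bridge», one level below g28).  DIAL = the `2`-DIVISION FIELD
`L = K₀(E[2])`, the splitting field of the `2`-division cubic, read through the ARCHIMEDEAN SIGN of `Δ`
(`disc(cubic) = 16 Δ`): FINITE RANGE = `Gal(L/K₀) ≤ S₃` (index `1, 2, 3, 6`) × (sign pattern of `Δ` at the real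
places); GENERIC REGIME = index `6` with Allen's dyadic conditions = g28's ADS (print modulo ADC, unchanged);
BRIDGE (PROVED here, `modular_of_discTotallyPositive`): if `Δ` is TOTALLY POSITIVE then `L` is a totally real
(three real roots at every place: `Literature…conj_eq_of_mem_roots_of_discr_pos`), Galois, SOLVABLE (`≤ S₃`)
extension of `K₀`, `E ⊗ L` has FULL `2`-torsion, the same moduli degree and `Δ ≠ 0`, `[L:ℚ] ≥ 6`, and `L` is either
again a box field or ANCHORED; so `E ⊗ L` is modular by F2T (box) or F2T_anch (anchored), and `E` is modular by
solvable descent DESC (g27's print junction `JDegreeFilterSplit.SolvableDescentModularity`, Langlands 1980 /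
Thorne 2016 Lemma 7.1).  Hence the whole TOTALLY-POSITIVE part of RES — all of R_sq (a square is totally positive),
and the `Δ ≫ 0` halves of R_tors and R_ss — collapses onto ONE core statement F2T = «full-`2`-torsion curves of
residual moduli degree over box fields are modular» (`ρ̄_{E,2}` TRIVIAL: the bottom of the dial), and the residual
shrinks to the curves with `Δ < 0` at some real place:

  RES ⟺ F2T ∧ R₂⁻ ∧ R_ss⁻ ∧ R_cm⁶   (junctions DESC, F2T_anch; `residual_iff_pieces`; necessity unconditional).

PIECES (decls of this file; tags for the cell):
* F2T  `FullTwoTorsionResidual` — NEW RESIDUAL CORE · WEAKER (⟸ R_tors AND ⟸ R_sq, both proved here) · IDEA-NEEDED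
  (no print over a general totally real field: Kraus 2019 Thms 2–3 ASSUME it; Anni–Siksek 2016 Thm 2 needs `K` real
  abelian; Thorne 2026 Thm B is potential; Kisin `2`-adic / [KW2] need non-solvable residual image).
* R₂⁻  `MixedSignTwoTorsionResidual` — residual · WEAKER (⟸ R_tors) · IDEA-NEEDED: a rational `2`-torsion point and
  `Δ < 0` at some real place.
* R_ss⁻ `NegativePlaceSupersingularResidual` — residual · WEAKER (⟸ R_ss) · IDEA-NEEDED: no rational `2`-torsion,
  `v(j) > 0` at some `v ∣ 2`, `Δ < 0` somewhere.
* R_cm⁶ `IrreducibleCMComponentResidual` — residual · WEAKER (⟸ R_cm) · IDEA-NEEDED / BARRIER-candidate: no rational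
  `2`-torsion, `Δ` totally negative and a dyadic square everywhere (Allen's CM-component corner, index `6`).
* F2T_anch `AnchoredFullTwoTorsion` — GLUE · S-IMPLIED, NOT RES-implied (the declared PRICE of the overfield move):
  full-`2`-torsion curves of residual moduli degree over ANCHORED fields of degree `≥ 6`; its (A)-cell is discharged
  from the tree facts `Yoshikawa2019_theorem1_2` / `Thorne2019_thm1` BY NAME (`anchoredFullTwoTorsion_of_cells`),
  leaving F2T_B `AnchoredBFullTwoTorsion` (the `15`/`21`-stable solvable-cover cells = E-level cores of host items
  stmt-Langlands-26996/26997 on the full-`2`-torsion locus; PRINT BRIDGE by proof: Thorne 2016 Thm 7.6, Yoshikawa).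
* DESC (tree, g27) and ADC/ADS (tree, g28) — PRINT junctions, unchanged.

KERNEL: `modular_of_discTotallyPositive` (the bridge), `residual_iff_pieces` (exactness), the WEAKER certificates
`fullTwoTorsionResidual_of_rationalTwoTorsion` / `_of_squareDisc` / …, and the compositions BY NAME
`largeJResidual_of_leaves` / `largeJResidual_of_cells` (→ LJR via g28's `largeJResidual_of_sectors`),
`restE_of_leaves` (→ REST_E via `JDegreeFilterSplit.restE_of_jLeaves`), `closes_target` / `closes_byName` (→ REST
stmt-Langlands-26998 via `JDegreeFilterSplit.closes_target`).  0 sorry; axioms of `closes_target`: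
[propext, Classical.choice, Quot.sound].  No `instance`, no `notation`; helper names never bare `closes`.
-/

set_option linter.dupNamespace false
set_option linter.unusedVariables false

open scoped NumberField IntermediateField ComplexConjugate
open NumberField IsDedekindDomain Literature.NumberTheory.Automorphic
open Summit.Langlands.Langlands.Theorems.DepthIsolationSplit (UnanchoredBox UnanchoredHighDegreeModularE
  IntegralModelTransferPointwise SatakeAvatarTwo satakeAvatarTwo_of_host)
open Summit.Langlands.Langlands.Theorems.JDegreeFilterSplit (jInv jDeg InResidualRange LargeJResidual
  RatBaseChangeModularity SmallFieldBaseChange SolvableDescentModularity jInv_baseChange jDeg_baseChange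
  baseChange_Δ_ne_zero restE_of_jLeaves largeJResidual_of_restE)
open Summit.Langlands.Langlands.Theorems.DyadicDoorSplit (disc JNonposAtTwo NoRationalTwoTorsion DiscNonsquare
  AllenConditionC AllenLocus AllenDyadicCorollary AllenDoorSector DyadicDegenerateResidual
  RationalTwoTorsionResidual SquareDiscResidual SupersingularAtTwoResidual CMComponentResidual
  not_allenLocus_iff residual_iff_subloci largeJResidual_of_sectors allenDoorSector_of_corollary
  not_isSquare_of_realEmbedding_neg twoTorsionPolynomial_map baseChange_baseChange_eq_map disc_baseChange)

namespace Summit.Langlands.Langlands.Theorems.TwoDivisionFieldSplit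

/-! ## §4 Kernel: the bridge (PROVED), exactness, weaker-certificates -/

/-- THE BRIDGE (PROVED; junctions: DESC = g27's `SolvableDescentModularity` (print, Langlands 1980 / Thorne 2016
Lemma 7.1) and F2T_anch): an integral curve of residual moduli degree over a box field whose discriminant is
TOTALLY POSITIVE is modular, GIVEN F2T on box fields and on anchored fields — its `2`-division field
`L = K₀(E[2])` is totally real (§2), Galois over `K₀` with solvable group (§2), `E ⊗ L` has full `2`-torsion and
the same moduli degree, `[L:ℚ] ≥ 6`, and `L` is either a box field (F2T) or anchored (F2T_anch); descend along
`L/K₀` by DESC.  This moves ALL of g28's R_sq, and the `Δ ≫ 0` halves of R_tors and R_ss, onto F2T. -/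
theorem modular_of_discTotallyPositive (hF : FullTwoTorsionResidual) (hA : AnchoredFullTwoTorsion)
    (hD : SolvableDescentModularity) (K₀ : Type) [Field K₀] [NumberField K₀] (hb : UnanchoredBox K₀)
    (E : WeierstrassCurve (𝓞 K₀)) (hΔ : E.Δ ≠ 0) (hr : InResidualRange K₀ E)
    (hpos : DiscTotallyPositive K₀ E) : IsModularEllipticCurve K₀ E := by
  haveI : IsTotallyReal K₀ := hb.1
  have ha := twoTorsionPolynomial_a_ne_zero K₀ E
  have hdiscr := twoTorsionPolynomial_discr_eq K₀ E
  set P : Cubic K₀ := (E.baseChange K₀).twoTorsionPolynomial with hP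
  have hdpos : ∀ σ : K₀ →+* ℝ, 0 < σ P.discr := fun σ => by
    rw [hdiscr, map_mul, map_ofNat]
    exact mul_pos (by norm_num) (hpos σ)
  have hd0 : P.discr ≠ 0 := by
    rw [hdiscr]
    exact mul_ne_zero (by norm_num) (disc_ne_zero K₀ E hΔ)
  haveI : NumberField P.toPoly.SplittingField := NumberField.of_module_finite K₀ P.toPoly.SplittingField
  haveI : IsTotallyReal P.toPoly.SplittingField := isTotallyReal_splittingField_cubic K₀ P ha hdpos
  obtain ⟨hgal, hsol⟩ := isGalois_isSolvable_splittingField_cubic K₀ P ha hd0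
  haveI := hgal
  haveI := hsol
  have hΔL : (E.baseChange (𝓞 P.toPoly.SplittingField)).Δ ≠ 0 :=
    baseChange_Δ_ne_zero K₀ P.toPoly.SplittingField E hΔ
  have hrL : InResidualRange P.toPoly.SplittingField (E.baseChange (𝓞 P.toPoly.SplittingField)) :=
    inResidualRange_baseChange K₀ P.toPoly.SplittingField E hr
  have hftL : FullTwoTorsion P.toPoly.SplittingField (E.baseChange (𝓞 P.toPoly.SplittingField)) :=
    fullTwoTorsion_baseChange_of_splits K₀ P.toPoly.SplittingField E
      (Polynomial.SplittingField.splits P.toPoly)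
  have hdegL : ¬ (Module.finrank ℚ P.toPoly.SplittingField ≤ 5) := by
    intro hle
    apply hb.2.1
    calc Module.finrank ℚ K₀
        ≤ Module.finrank ℚ K₀ * Module.finrank K₀ P.toPoly.SplittingField :=
          Nat.le_mul_of_pos_right _ Module.finrank_pos
      _ = Module.finrank ℚ P.toPoly.SplittingField :=
          Module.finrank_mul_finrank ℚ K₀ P.toPoly.SplittingField
      _ ≤ 5 := hle
  have hmodL : IsModularEllipticCurve P.toPoly.SplittingField
      (E.baseChange (𝓞 P.toPoly.SplittingField)) := by
    by_cases hboxL : UnanchoredBox P.toPoly.SplittingField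
    · exact hF P.toPoly.SplittingField hboxL _ hΔL hrL hftL
    · exact hA P.toPoly.SplittingField inferInstance hdegL hboxL _ hΔL hrL hftL
  exact hD K₀ P.toPoly.SplittingField E hΔ hmodL

/-- NECESSITY (unconditional): RES ⇒ each of the four residual pieces (sector projections). -/
theorem pieces_of_residual (h : DyadicDegenerateResidual) :
    FullTwoTorsionResidual ∧ MixedSignTwoTorsionResidual ∧ NegativePlaceSupersingularResidual ∧
      IrreducibleCMComponentResidual := by
  refine ⟨?_, ?_, ?_, ?_⟩
  · intro K₀ _ _ hb E hΔ hr hft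
    exact h K₀ hb E hΔ hr ((not_allenLocus_iff K₀ E).2 (Or.inl (exists_root_of_fullTwoTorsion K₀ E hft)))
  · intro K₀ _ _ hb E hΔ hr hx hneg
    exact h K₀ hb E hΔ hr ((not_allenLocus_iff K₀ E).2 (Or.inl hx))
  · intro K₀ _ _ hb E hΔ hr hT hv hneg
    exact h K₀ hb E hΔ hr ((not_allenLocus_iff K₀ E).2 (Or.inr (Or.inr (Or.inl hv))))
  · intro K₀ _ _ hb E hΔ hr hT hneg hall
    exact h K₀ hb E hΔ hr ((not_allenLocus_iff K₀ E).2 (Or.inr (Or.inr (Or.inr ⟨hneg, hall⟩))))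

/-- SUFFICIENCY (junctions DESC, F2T_anch): the bridge on the totally positive locus, the three negative-place
pieces off it. -/
theorem residual_of_pieces (hD : SolvableDescentModularity) (hA : AnchoredFullTwoTorsion)
    (hF : FullTwoTorsionResidual) (hR₂ : MixedSignTwoTorsionResidual)
    (hss : NegativePlaceSupersingularResidual) (hcm : IrreducibleCMComponentResidual) :
    DyadicDegenerateResidual := by
  intro K₀ _ _ hb E hΔ hr hnot
  by_cases hpos : DiscTotallyPositive K₀ E
  · exact modular_of_discTotallyPositive hF hA hD K₀ hb E hΔ hr hpos
  · have hneg := exists_neg_of_not_discTotallyPositive K₀ E hΔ hpos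
    by_cases hx : ∃ x : K₀, ((E.baseChange K₀).twoTorsionPolynomial).toPoly.IsRoot x
    · exact hR₂ K₀ hb E hΔ hr hx hneg
    · have hT : NoRationalTwoTorsion K₀ E := fun x hx' => hx ⟨x, hx'⟩
      rcases (not_allenLocus_iff K₀ E).1 hnot with hx' | hsq | hv | ⟨hneg', hall⟩
      · exact absurd hx' hx
      · exact absurd hneg (not_exists_neg_of_discTotallyPositive K₀ E
          (discTotallyPositive_of_isSquare K₀ E hΔ hsq))
      · exact hss K₀ hb E hΔ hr hT hv hneg
      · exact hcm K₀ hb E hΔ hr hT hneg' hall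

/-- EXACTNESS (junctions DESC, F2T_anch): RES ⟺ F2T ∧ R₂⁻ ∧ R_ss⁻ ∧ R_cm⁶. -/
theorem residual_iff_pieces (hD : SolvableDescentModularity) (hA : AnchoredFullTwoTorsion) :
    DyadicDegenerateResidual ↔ FullTwoTorsionResidual ∧ MixedSignTwoTorsionResidual ∧
      NegativePlaceSupersingularResidual ∧ IrreducibleCMComponentResidual :=
  ⟨pieces_of_residual, fun h => residual_of_pieces hD hA h.1 h.2.1 h.2.2.1 h.2.2.2⟩

/-! ### WEAKER-certificates: every new residual piece is a sub-case of a g28 sub-locus -/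

/-- F2T ⟸ R_tors. -/
theorem fullTwoTorsionResidual_of_rationalTwoTorsion (h : RationalTwoTorsionResidual) :
    FullTwoTorsionResidual :=
  fun K₀ _ _ hb E hΔ hr hft => h K₀ hb E hΔ hr (exists_root_of_fullTwoTorsion K₀ E hft)

/-- F2T ⟸ R_sq (full `2`-torsion forces `Δ ∈ K₀²`): R_sq is ABSORBED. -/
theorem fullTwoTorsionResidual_of_squareDisc (h : SquareDiscResidual) : FullTwoTorsionResidual :=
  fun K₀ _ _ hb E hΔ hr hft => h K₀ hb E hΔ hr (isSquare_disc_of_fullTwoTorsion K₀ E hft)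

/-- R₂⁻ ⟸ R_tors. -/
theorem mixedSignTwoTorsionResidual_of_rationalTwoTorsion (h : RationalTwoTorsionResidual) :
    MixedSignTwoTorsionResidual :=
  fun K₀ _ _ hb E hΔ hr hx _ => h K₀ hb E hΔ hr hx

/-- R_ss⁻ ⟸ R_ss. -/
theorem negativePlaceSupersingularResidual_of_supersingular (h : SupersingularAtTwoResidual) :
    NegativePlaceSupersingularResidual :=
  fun K₀ _ _ hb E hΔ hr _ hv _ => h K₀ hb E hΔ hr hv

/-- R_cm⁶ ⟸ R_cm. -/
theorem irreducibleCMComponentResidual_of_cm (h : CMComponentResidual) : IrreducibleCMComponentResidual :=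
  fun K₀ _ _ hb E hΔ hr _ hneg hall => h K₀ hb E hΔ hr hneg hall

/-! ## §5 Compositions by name: up to LJR, REST_E and REST (stmt-Langlands-26998) -/

/-- KERNEL (leaf level) up to LJR: ADC (g28's print junction) → DESC → F2T_anch → F2T → R₂⁻ → R_ss⁻ → R_cm⁶ → LJR,
through g28's `largeJResidual_of_sectors` BY NAME. -/
theorem largeJResidual_of_leaves (hADC : AllenDyadicCorollary) (hD : SolvableDescentModularity)
    (hA : AnchoredFullTwoTorsion) (hF : FullTwoTorsionResidual) (hR₂ : MixedSignTwoTorsionResidual)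
    (hss : NegativePlaceSupersingularResidual) (hcm : IrreducibleCMComponentResidual) : LargeJResidual :=
  largeJResidual_of_sectors (allenDoorSector_of_corollary hADC) (residual_of_pieces hD hA hF hR₂ hss hcm)

/-- The same with F2T_anch opened into its cells: (A) from the tree facts BY NAME, (B) the print-bridge cell. -/
theorem largeJResidual_of_cells (hADC : AllenDyadicCorollary) (hD : SolvableDescentModularity)
    (hY : Yoshikawa2019_theorem1_2) (hTh : Thorne2019_thm1) (hB : AnchoredBFullTwoTorsion)
    (hF : FullTwoTorsionResidual) (hR₂ : MixedSignTwoTorsionResidual)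
    (hss : NegativePlaceSupersingularResidual) (hcm : IrreducibleCMComponentResidual) : LargeJResidual :=
  largeJResidual_of_leaves hADC hD (anchoredFullTwoTorsion_of_cells hY hTh hB) hF hR₂ hss hcm

/-- KERNEL up to REST_E: the g27 leaves with LJR replaced by the leaves above, through the tree's
`JDegreeFilterSplit.restE_of_jLeaves`. -/
theorem restE_of_leaves (hDBC : RatBaseChangeModularity) (hNSBC : SmallFieldBaseChange)
    (hFLS : FLS2015_theorem1) (hDNS : DNS2020_theorem4) (hBox : Box2022_theorem1_1)
    (hADC : AllenDyadicCorollary) (hD : SolvableDescentModularity)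
    (hY : Yoshikawa2019_theorem1_2) (hTh : Thorne2019_thm1) (hB : AnchoredBFullTwoTorsion)
    (hF : FullTwoTorsionResidual) (hR₂ : MixedSignTwoTorsionResidual)
    (hss : NegativePlaceSupersingularResidual) (hcm : IrreducibleCMComponentResidual) :
    UnanchoredHighDegreeModularE :=
  restE_of_jLeaves hDBC hNSBC hFLS hDNS hBox (largeJResidual_of_cells hADC hD hY hTh hB hF hR₂ hss hcm)

/-- KERNEL COMPOSITION concluding REST = `TowerDoorSplit.UnanchoredHighDegreeWitnessAutomorphy`
(stmt-Langlands-26998) BY NAME, through the tree's `JDegreeFilterSplit.closes_target` (IMT → TRANY → W⁺|₂ → R1). -/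
theorem closes_target (hDBC : RatBaseChangeModularity) (hNSBC : SmallFieldBaseChange)
    (hFLS : FLS2015_theorem1) (hDNS : DNS2020_theorem4) (hBox : Box2022_theorem1_1)
    (hADC : AllenDyadicCorollary) (hD : SolvableDescentModularity)
    (hY : Yoshikawa2019_theorem1_2) (hTh : Thorne2019_thm1) (hB : AnchoredBFullTwoTorsion)
    (hF : FullTwoTorsionResidual) (hR₂ : MixedSignTwoTorsionResidual)
    (hss : NegativePlaceSupersingularResidual) (hcm : IrreducibleCMComponentResidual)
    (hIMT : IntegralModelTransferPointwise)
    (hTr : Summit.Langlands.Langlands.Theses.EllipticDegreeLadder.EllipticTransportAnyBase)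
    (hW : SatakeAvatarTwo)
    (h1 : Summit.Langlands.Langlands.Theses.EllipticDegreeLadder.RankOneAutomorphy) :
    Summit.Langlands.Langlands.Theses.TowerDoorSplit.UnanchoredHighDegreeWitnessAutomorphy :=
  Summit.Langlands.Langlands.Theorems.JDegreeFilterSplit.closes_target hDBC hNSBC hFLS hDNS hBox
    (largeJResidual_of_cells hADC hD hY hTh hB hF hR₂ hss hcm) hIMT hTr hW h1

/-- `closes_target` with W⁺ the host item `SatakeAvatarExistence` (stmt-Langlands-17415) BY NAME. -/
theorem closes_byName (hDBC : RatBaseChangeModularity) (hNSBC : SmallFieldBaseChange)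
    (hFLS : FLS2015_theorem1) (hDNS : DNS2020_theorem4) (hBox : Box2022_theorem1_1)
    (hADC : AllenDyadicCorollary) (hD : SolvableDescentModularity)
    (hY : Yoshikawa2019_theorem1_2) (hTh : Thorne2019_thm1) (hB : AnchoredBFullTwoTorsion)
    (hF : FullTwoTorsionResidual) (hR₂ : MixedSignTwoTorsionResidual)
    (hss : NegativePlaceSupersingularResidual) (hcm : IrreducibleCMComponentResidual)
    (hIMT : IntegralModelTransferPointwise)
    (hTr : Summit.Langlands.Langlands.Theses.EllipticDegreeLadder.EllipticTransportAnyBase)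
    (hW : Summit.Langlands.Langlands.Theses.EllipticDegreeLadder.SatakeAvatarExistence)
    (h1 : Summit.Langlands.Langlands.Theses.EllipticDegreeLadder.RankOneAutomorphy) :
    Summit.Langlands.Langlands.Theses.TowerDoorSplit.UnanchoredHighDegreeWitnessAutomorphy :=
  closes_target hDBC hNSBC hFLS hDNS hBox hADC hD hY hTh hB hF hR₂ hss hcm hIMT hTr (satakeAvatarTwo_of_host hW) h1

/-! ### Necessity from the lineage targets (the trivial direction) -/

/-- LJR ⇒ the four residual pieces. -/
theorem pieces_of_largeJResidual (h : LargeJResidual) :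
    FullTwoTorsionResidual ∧ MixedSignTwoTorsionResidual ∧ NegativePlaceSupersingularResidual ∧
      IrreducibleCMComponentResidual :=
  pieces_of_residual (Summit.Langlands.Langlands.Theorems.DyadicDoorSplit.residual_of_largeJResidual h)

/-- REST_E ⇒ the four residual pieces. -/
theorem pieces_of_restE (h : UnanchoredHighDegreeModularE) :
    FullTwoTorsionResidual ∧ MixedSignTwoTorsionResidual ∧ NegativePlaceSupersingularResidual ∧
      IrreducibleCMComponentResidual :=
  pieces_of_largeJResidual (largeJResidual_of_restE h)

end Summit.Langlands.Langlands.Theorems.TwoDivisionFieldSplit
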